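import Mathlib.NumberTheory.Padics.Complex
import Literature.NumberTheory.Automorphic.AdicCompletionLocalField
import Literature.NumberTheory.Automorphic.AdicCompletionResidueCard
import Literature.NumberTheory.GaloisRepresentations.DecompositionGroupOfCompletion
import Literature.NumberTheory.GaloisRepresentations.LocalGaloisGroupFrobeniusProofs
import Literature.NumberTheory.GaloisRepresentations.TateTwistFrobeniusProofs
import Literature.NumberTheory.GaloisRepresentations.WeilGroup
import HarnessLib

/-!
# Line `Sketch` for the crux `ReciprocityUpToIrreducibility` (item stmt-Langlands-14328), wave N15-B:
# the powers of the cyclotomic character on the local Weil group away from `ℓ`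

Support file (closes nothing; stub `stub_cyclotomic_zpow_localWeil` of the registered skeleton of
line `Sketch`, continuation lead c10).  Let `K` be a number field, `ℓ` a prime, `k ∈ ℤ`, and
`ε : Γ_K →ₜ* ℚ̄_ℓˣ` a continuous character with `ε(σ) = χ_ℓ(σ)^k` pointwise (`χ_ℓ` the `ℓ`-adic
cyclotomic character `GaloisRep.cyclotomicCharacter K ℓ`; such an `ε` exists,
`exists_cyclotomicCharacter_padicAlgCl_zpow`).  For a finite place `v ∤ ℓ` with completion `K_v`,
restriction `res : Γ_{K_v} → Γ_K` along the chosen embedding `K̄ → \bar K_v` (`absGaloisRestrict`)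
and distinguished prime `𝔓₀ = adicCompletionPrime K v` above `v`:

* §1 `cyclotomic_zpow_absGaloisRestrict_eq_one_of_mem_absInertia` — `ε ∘ res` is trivial on the
  local inertia group `I_{K_v}`: `res (I_{K_v}) = I_{𝔓₀}` (Neukirch, Ch. II (9.6); tree
  `inertia_adicCompletionPrime_eq_map_absInertia`) and `ε` is trivial on `I_{𝔓₀}`
  (`eq_one_of_mem_inertia_of_cyclotomic_zpow`: `χ_ℓ` is unramified away from `ℓ`).
* §2 `coe_cyclotomic_zpow_absGaloisRestrict_of_isFrobPow` — if `σ ∈ Γ_{K_v}` acts on the residue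
  field of `\bar K_v` as the `d`-th power of the ARITHMETIC Frobenius (`IsFrobPow σ d`, `d ∈ ℤ`),
  then `ε (res σ) = q_v^{k d}`: `σ = (σ φ^{-d}) φ^d` with `φ` a local arithmetic Frobenius
  (`exists_isAbsArithFrob_holds`), `σ φ^{-d}` inertial (`IsFrobPow.mul_inv_mem_absInertia_holds`),
  `res φ` an arithmetic Frobenius at `𝔓₀` (`isArithFrobAt_absGaloisRestrict_adicCompletionPrime_iff`)
  and `ε(Frob_v^{arith}) = q_v^k` (`coe_apply_of_isArithFrobAt_of_cyclotomic_zpow`).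
* §3 the stub, verbatim: for `w ∈ W_{K_v}`, `ε(w|_{K̄}) = q_v^{k · deg w}` (`WeilGroup.isFrobPow_deg`;
  Deligne's convention `deg (geometric Frobenius) = -1`, so a geometric Frobenius goes to `q_v^{-k}`).

References: J.-P. Serre, *Abelian ℓ-adic representations and elliptic curves* (1968), Ch. I §1.2
[SerreAbelianLadic1968]; J. Tate, *Number theoretic background*, Corvallis 1979, (1.4.1), (4.1.3)
[TateCorvallis1979]; J. Neukirch, *Algebraic Number Theory* (1999), Ch. II §9 Prop. (9.6)
[NeukirchANT1999].  No new definitions; axioms `propext`, `Classical.choice`, `Quot.sound`.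
-/

noncomputable section

set_option linter.dupNamespace false -- project-wide option (lakefile weak.linter.dupNamespace); `Summit.Langlands.Langlands` is the mandated namespace

open scoped NumberField Classical
open IsDedekindDomain Field
open Literature.NumberTheory.Automorphic Literature.NumberTheory.GaloisRepresentations
open Literature.NumberTheory.GaloisRepresentations.IsNonarchimedeanLocalField (residueFieldCard)

namespace Summit.Langlands.Langlands.Theorems.ReciprocityUpToIrreducibility

variable {K : Type} [Field K] [NumberField K] {ℓ : ℕ} [Fact ℓ.Prime]

/-! ## 1. `ε_ℓ^k` is trivial on the local inertia group at `v ∤ ℓ` -/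

/-- **`ε_ℓ^k ∘ res` is trivial on `I_{K_v}` for `v ∤ ℓ`**: the restriction map sends the local
inertia group onto the inertia group of the distinguished prime `𝔓₀ ∣ v`
(`inertia_adicCompletionPrime_eq_map_absInertia`), on which `ε_ℓ^k` is trivial because the
cyclotomic character is unramified away from `ℓ` (`eq_one_of_mem_inertia_of_cyclotomic_zpow`).
[cite: SerreAbelianLadic1968, Ch. I §1.2 (Example: the cyclotomic character)]
[cite: NeukirchANT1999, Ch. II §9 Prop. (9.6)] -/
theorem cyclotomic_zpow_absGaloisRestrict_eq_one_of_mem_absInertia {k : ℤ}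
    {ε : absoluteGaloisGroup K →ₜ* (PadicAlgCl ℓ)ˣ}
    (hε : ∀ σ, (ε σ : PadicAlgCl ℓ) =
      (algebraMap ℚ_[ℓ] (PadicAlgCl ℓ)
        ((GaloisRep.cyclotomicCharacter K ℓ σ : ℤ_[ℓ]ˣ) : ℤ_[ℓ])) ^ k)
    {v : HeightOneSpectrum (𝓞 K)} (hv : ((ℓ : ℕ) : 𝓞 K) ∉ v.asIdeal)
    {τ : absoluteGaloisGroup (v.adicCompletion K)} (hτ : τ ∈ absInertia (v.adicCompletion K)) :
    ε (absGaloisRestrict K (v.adicCompletion K) τ) = 1 :=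
  eq_one_of_mem_inertia_of_cyclotomic_zpow hε hv (adicCompletionPrime_mem_primesAbove K v) <| by
    rw [inertia_adicCompletionPrime_eq_map_absInertia]
    exact Subgroup.mem_map_of_mem _ hτ

/-! ## 2. The value of `ε_ℓ^k` on an element of `Γ_{K_v}` of Frobenius degree `d` -/

/-- **`ε_ℓ^k (res σ) = q_v^{k d}` for `σ ∈ Γ_{K_v}` of Frobenius degree `d`** (`IsFrobPow σ d`:
`σ` acts on the residue field of `\bar K_v` as the `d`-th power of the arithmetic Frobenius),
`v ∤ ℓ`: write `σ = (σ φ^{-d}) · φ^d` with `φ` a local arithmetic Frobenius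
(`exists_isAbsArithFrob_holds`); the first factor is inertial
(`IsFrobPow.mul_inv_mem_absInertia_holds`), hence killed by `ε_ℓ^k` (§1), and `res φ` is an
arithmetic Frobenius at `𝔓₀` (`isArithFrobAt_absGaloisRestrict_adicCompletionPrime_iff`), where
`ε_ℓ^k` takes the value `q_v^k` (`coe_apply_of_isArithFrobAt_of_cyclotomic_zpow`).
[cite: SerreAbelianLadic1968, Ch. I §1.2 (Example: the cyclotomic character)]
[cite: TateCorvallis1979, (1.4.1) and (4.1.3)] -/
theorem coe_cyclotomic_zpow_absGaloisRestrict_of_isFrobPow {k : ℤ}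
    {ε : absoluteGaloisGroup K →ₜ* (PadicAlgCl ℓ)ˣ}
    (hε : ∀ σ, (ε σ : PadicAlgCl ℓ) =
      (algebraMap ℚ_[ℓ] (PadicAlgCl ℓ)
        ((GaloisRep.cyclotomicCharacter K ℓ σ : ℤ_[ℓ]ˣ) : ℤ_[ℓ])) ^ k)
    {v : HeightOneSpectrum (𝓞 K)} (hv : ((ℓ : ℕ) : 𝓞 K) ∉ v.asIdeal)
    {σ : absoluteGaloisGroup (v.adicCompletion K)} {d : ℤ} (hσ : IsFrobPow σ d) :
    (ε (absGaloisRestrict K (v.adicCompletion K) σ) : PadicAlgCl ℓ) =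
      (v.residueCard : PadicAlgCl ℓ) ^ (k * d) := by
  -- a local arithmetic Frobenius `φ` and its powers
  obtain ⟨φ, hφ⟩ := exists_isAbsArithFrob_holds (v.adicCompletion K)
  have h1 : IsFrobPow φ 1 := IsAbsArithFrob.isFrobPow_holds hφ
  have hφd : IsFrobPow (φ ^ d) d := by simpa using h1.zpow d
  -- `σ (φ ^ d)⁻¹` is inertial, hence killed by `ε`
  have hin : σ * (φ ^ d)⁻¹ ∈ absInertia (v.adicCompletion K) :=
    IsFrobPow.mul_inv_mem_absInertia_holds hσ hφd
  have hker : ε (absGaloisRestrict K (v.adicCompletion K) (σ * (φ ^ d)⁻¹)) = 1 :=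
    cyclotomic_zpow_absGaloisRestrict_eq_one_of_mem_absInertia hε hv hin
  -- the restriction of `φ` is an arithmetic Frobenius at `𝔓₀`, so `ε (res φ) = q_v ^ k`
  have hqN : residueFieldCard (v.adicCompletion K) = Nat.card (𝓞 K ⧸ v.asIdeal) :=
    (residueFieldCard_adicCompletion_eq K v).trans (HeightOneSpectrum.residueCard_eq_card_quotient v)
  have hF : IsArithFrobAt (𝓞 K) (absGaloisRestrict K (v.adicCompletion K) φ)
      (adicCompletionPrime K v) :=
    (isArithFrobAt_absGaloisRestrict_adicCompletionPrime_iff K v hqN φ).mpr hφ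
  have hφval : (ε (absGaloisRestrict K (v.adicCompletion K) φ) : PadicAlgCl ℓ) =
      (v.residueCard : PadicAlgCl ℓ) ^ k :=
    coe_apply_of_isArithFrobAt_of_cyclotomic_zpow hε hv (adicCompletionPrime_mem_primesAbove K v) hF
  have hσeq : σ = (σ * (φ ^ d)⁻¹) * φ ^ d := by group
  rw [hσeq, map_mul, map_mul, hker, one_mul, map_zpow, map_zpow, Units.val_zpow_eq_zpow_val, hφval,
    ← zpow_mul]

/-! ## 3. The registered stub -/

/-- **stub N15-B (the cyclotomic character on the local Weil group away from `ℓ`).**  For `ε = ε_ℓ^k`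
(`k ∈ ℤ`) and a finite place `v ∤ ℓ`: for every `w ∈ W_{K_v}`, `ε(w|_{K̄}) = q_v^{k · deg w}` — `ε_ℓ` is
unramified at `v` (`eq_one_of_mem_inertia_of_cyclotomic_zpow` on the inertia groups above `v`, which contain
the image of the local inertia, `inertia_adicCompletionPrime_eq_map_absInertia`), an element of degree `d`
restricts to a `d`-th power of an ARITHMETIC Frobenius class at the distinguished prime above `v`
(`WeilGroup.isFrobPow_deg`), and `ε_ℓ(Frob_v^{arith}) = q_v` (`coe_apply_of_isArithFrobAt_of_cyclotomic_zpow`);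
Deligne's convention `deg (geometric Frobenius) = -1`.
[cite: SerreAbelianLadic1968, Ch. I §1.2] [cite: TateCorvallis1979, (1.4.1), (4.1.3)] -/
theorem stub_cyclotomic_zpow_localWeil :
    ∀ (K : Type) [Field K] [NumberField K] (ℓ : ℕ) [Fact ℓ.Prime] (k : ℤ)
      (ε : Field.absoluteGaloisGroup K →ₜ* (PadicAlgCl ℓ)ˣ),
      (∀ σ, (ε σ : PadicAlgCl ℓ) =
        (algebraMap ℚ_[ℓ] (PadicAlgCl ℓ) ((GaloisRep.cyclotomicCharacter K ℓ σ : ℤ_[ℓ]ˣ) : ℤ_[ℓ])) ^ k) →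
      ∀ (v : HeightOneSpectrum (𝓞 K)), ((ℓ : ℕ) : 𝓞 K) ∉ v.asIdeal →
      ∀ w : WeilGroup (v.adicCompletion K),
        (ε (absGaloisRestrict K (v.adicCompletion K) (WeilGroup.toAbsGalois (v.adicCompletion K) w)) :
            PadicAlgCl ℓ) =
          ((v.residueCard : ℕ) : PadicAlgCl ℓ) ^ (k * WeilGroup.deg w) :=
  fun _ _ _ _ _ _ _ hε _ hv w =>
    coe_cyclotomic_zpow_absGaloisRestrict_of_isFrobPow hε hv (WeilGroup.isFrobPow_deg IsFrobPow.mul_holds w)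

end Summit.Langlands.Langlands.Theorems.ReciprocityUpToIrreducibility

end
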